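import Mathlib
import HarnessLib
import HarnessLib.Audit
import Summits.CriticalPhenomena.Statement

/-!
Route: PercDiodeSteering

DORMANT since 2026-08-30T23:18:49Z (reconciler: no traction for 5 d (last activity statement-closed at 2026-08-25T22:11:23Z); parked, not closed — `ledger route dormant route-CriticalPhenomena-PercDiodeSteering --off` to reactivate) — unstaffed, not closed; items shared with open routes are served there. `ledger route dormant <id> --off` reactivates.

# Route PercDiodeSteering — resistor–diode steering ladder — θ⁺=0 on the directed side of Redner's
diagram by same-parameter steering over a subcritical resistor backbone; ℤ³ is the endpoint where
the budget p_c−a = 0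

Deform the MEASURE along the one axis with a solved endpoint of another universality class:
ORIENTATION (card
resistor-diode-steering-ladder, the only card realised). Resistor–diode network (RDN) on ℤ³ with
i.i.d. uniform labels
U_e (law `labelMeasure`): in the (p, r)-parametrisation a forward step x ⋖ z (z = x + eᵢ) is
passable iff U ≤ p, a
backward step iff U ≤ p·r (resistor density a = p r, positive-diode density b = p(1−r)); θ⁺(p, r) =
P(forward cluster of 0
is infinite); r = 1 is Bernoulli(p) bond percolation on ℤ³ (the conjunct lives at (p_c, 1)), r = 0
is oriented bond
percolation, where θ(p_c) = 0 is a THEOREM (GrimmettHiemer2002 Thm 1). It suffices to show X =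
BackboneSteering ∧
DiodeEnhancement ∧ UniformSteering: (BS) on the directed side, wherever the resistor backbone is
subcritical
(p r < p_c(ℤ³)), forward percolation is an open condition downward in p — equivalently θ⁺ vanishes
on the critical curve
there (same-parameter steering: the budget β = p_c − a > 0 replaces Grimmett–Marstrand's
sprinkling); (DE) for every
r ∈ (0,1) some percolating point has a subcritical backbone (Aizenman–Grimmett strictness for the
diode enhancement: the
critical curve enters the isotropic point from a < p_c); (U) the residue: uniformly for r ↑ 1, θ⁺(·,
r) rises by at
most ε within δ above its critical point, measured from its critical VALUE. U is implied by the
conjunct outright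
(monotone domination + right-continuity of θ) and, given BS and DE, implies it back (Assembly,
sorry-free in the
planner's Sketch.lean); the claim of the line is that on the directed side U becomes 'control the
steering block scale
L(β) as β → 0'. The ladder rung SmallLeakSteering (oriented percolation with a small density of
two-way defects) is
the first new theorem and is provable-looking now.
Lean: `let θ : ℝ → ℝ → ℝ := (fun p r => (Literature.Probability.Percolation.labelMeasure
(Literature.Probability.LatticeModels.Site 3)).real {U | {y :
Literature.Probability.LatticeModels.Site 3 | Relation.ReflTransGen (fun x z :
Literature.Probability.LatticeModels.Site 3 => (x ⋖ z ∧ U s(x, z) ≤ p) ∨ (z ⋖ x ∧ U s(x, z) ≤ p *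
r)) 0 y}.Infinite}); (∀ r : ℝ, 0 ≤ r → r < 1 → ∀ p : ℝ, p * r <
Literature.Probability.Percolation.criticalProb (Literature.Probability.LatticeModels.zdGraph 3) 0 →
0 < θ p r → ∃ p' < p, 0 < θ p' r) ∧ (∀ r : ℝ, 0 < r → r < 1 → ∃ p : ℝ, p * r <
Literature.Probability.Percolation.criticalProb (Literature.Probability.LatticeModels.zdGraph 3) 0 ∧
0 < θ p r) ∧ (∀ ε > (0 : ℝ), ∃ δ > (0 : ℝ), ∃ r₀ < (1 : ℝ), ∀ r : ℝ, r₀ ≤ r → r < 1 → ∀ p : ℝ, sInf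
{q : ℝ | 0 < θ q r} ≤ p → p ≤ sInf {q : ℝ | 0 < θ q r} + δ → θ p r ≤ θ (sInf {q : ℝ | 0 < θ q r}) r
+ ε)`

## Assembly
Real analysis over in-tree facts, closed sorry-free in the planner's Sketch.lean (`assembly_holds`,
axioms propext /
Classical.choice / Quot.sound): fix ε > 0; UniformSteering gives δ, r₀; take r = max(r₀, 1/2,
1/(1+δ)) < 1;
DiodeEnhancement gives p₁ with p₁r < p_c and θ⁺(p₁, r) > 0; S = {q : θ⁺(q, r) > 0} is bounded below
by p_c
(RDMonotone + RDEndpoint + theta_eq_zero_of_lt_criticalProb_holds + theta_bot), so p* = inf S ∈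
[p_c, p₁] and
p*·r < p_c; BackboneSteering forces θ⁺(p*, r) = 0 (a smaller percolating q would undercut the
infimum); P = p_c/r
satisfies P·r = p_c, p_c ≤ P ≤ p_c + δ ≤ p* + δ, so θ(p_c) = θ⁺(p_c, 1) ≤ θ⁺(P, r) ≤ θ⁺(p*, r) + ε =
ε (or ≤ θ⁺(p*, r) = 0
if P < p*). Hence θ(p_c) = 0, i.e. PercolationContinuityZ3 (percolationContinuityZ3_iff,
coe_criticalProbI).
SmallLeakSteering is a rung (special case of BackboneSteering for r ≤ r₀) and deliberately not a
hypothesis.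

Rationale: WHY THIS LINE. The only solved nearest-neighbour i.i.d. model on all of ℤ³ (oriented percolation:
BezuidenhoutGrimmett1990,
GrimmettHiemer2002 Thm 1, dynamic renormalisation WITHOUT sprinkling because oriented growth only
enters fresh
territory) and the open one sit on one monotone critical curve of Redner's forty-year-old
resistor–diode network
(Redner1982, RednerBrown1981; field theory JanssenStenull2000: the bias is relevant at the isotropic
fixed point, every
r < 1 is in the directed-percolation class), and the proof resource is a coordinate along that
curve: the steering
budget β = p_c(ℤ³) − a, re-denominating Grimmett's 'extra money' (Grimmett1999 §7.3 p.162, barrier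
SprinklingRenormalisation) from density, unavailable at p_c, into time-likeness, available on the
whole directed side
and exhausted exactly at ℤ³. Imported: interacting-particle / oriented-percolation block technology
(BG90, GH02, the
steering of BarskyGrimmettNewman1991 = Grimmett1999 Thm (7.35)), Aizenman–Grimmett essential
enhancements
(AizenmanGrimmett1991; bond case certified by BalisterBollobasRiordan2014), subcritical sharpness
for the backbone
(in tree, PROVED: Literature.Probability.Percolation.DCT16.perc_sharpness_holds), and the physics of
isotropic-to-directed
crossover (JanssenStenull2000, ZhouEtAl2012) as calibration only. Correction to the card found while
planning: backward
excursions are NOT confined to resistor clusters (isolated resistors alternating with diodes make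
net-backward paths),
so time-likeness of the critical forward cluster is a separate large-scale input — provable by path
counting for
r ≲ 1/36 (P(net backward progress n) ≤ (6a)ⁿ/(1 − 6√(ap)) when 36ap < 1), which is why
SmallLeakSteering is a
separate, tractable rung, and conjectural (DP-class anisotropy) for general r < 1. No existing route
or negative of
this summit varies the orientation content of the measure (25 Theses files read; negatives index: 1
SAW statement).

RANKED CRUXES. #2 BackboneSteering (crux) — card R2 (RDNSteering). For every ratio 0 ≤ r < 1 and
every p with subcritical resistor backbone p·r < p_c(ℤ³): if the RDN percolates forward at (p, r)
then it still does at some p′ < p (same r). Equivalently θ⁺(p_c(r), r) = 0 whenever r·p_c(r) <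
p_c(ℤ³): continuity on the directed side of Redner's diagram, by a same-parameter (steering)
finite-size criterion whose blocks are fattened by the backward-leak scale. [difficulty:
open-problem] (why it might fail: a < p_c does not make critical forward clusters time-like
(diode+isolated-resistor paths go net-backward; GH10 Prop 7(b) with free backward steps already
needed sprinkling); without cone confinement steering has no time axis and meets the full
negative-information problem.) [GrimmettHiemer2002, BezuidenhoutGrimmett1990,
BarskyGrimmettNewman1991, Grimmett1999, GrimmettHolroyd2010, JanssenStenull2000]
#3 SmallLeakSteering (crux) — the first rung above the Grimmett–Hiemer endpoint: there is r₀ > 0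
such that for every leak ratio 0 ≤ r ≤ r₀ (oriented bond percolation on ℤ³ in which a p·r-fraction
of labels also opens the backward direction) forward percolation is an open condition downward in p,
i.e. θ⁺(·, r) vanishes at its critical point. At r = 0 this is GH02 Thm 1 (conventional model,
bond); for 0 < r ≤ r₀ net-backward progress n costs ≤ (6pr)ⁿ uniformly in p ≤ 1 (path counting), so
blocks fattened by C log L collars confine the exploration and GH02's seed-steering should survive.
[difficulty: XL] (why it might fail: even r=0 means rebuilding BG90/GH02 dynamic renormalisation for
BOND oriented percolation in the (1,1,1) conventional geometry (GH02 only remark it adapts); for r>0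
the O(log L)-fattened blocks overlap their predecessors' collars, and seed placement must provably
avoid every examined edge.) [GrimmettHiemer2002, BezuidenhoutGrimmett1990, Grimmett1999,
GrimmettHolroyd2010, Liggett2005]
#4 DiodeEnhancement (crux) — card R3 (SubcriticalBackboneAlongTheCurve), in the form the Assembly
uses: for every 0 < r < 1 there is p with p·r < p_c(ℤ³) and θ⁺(p, r) > 0 — at ratio r some
percolating point has a subcritical resistor backbone; equivalently r·p_c(r) < p_c(ℤ³), equivalently
a_c(b) < p_c(ℤ³) for every diode density b > 0 (positive diodes are an essential enhancement of
critical bond percolation for FORWARD reachability). Trivial bounds in tree-provable form: p_c(ℤ³) ≤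
p_c(r) ≤ p_c(ℤ³)/r. [difficulty: L] (why it might fail: AG needs 'resistor-pivotal ⟹ diode-pivotal
after bounded surgery'; a resistor used BACKWARD has no forward substitute, so the surgery must
reroute through a detour with a forward edge while keeping pivotality; a Russo formula for
three-state edges and uniformity as b → 0 are needed.) [AizenmanGrimmett1991,
BalisterBollobasRiordan2014, Grimmett1999, Redner1982]
#5 UniformSteering (crux) — card R4 recast as the exact residue: for every ε > 0 there are δ > 0 and
r₀ < 1 such that for all r ∈ [r₀, 1) and all p ∈ [p_c(r), p_c(r) + δ], θ⁺(p, r) ≤ θ⁺(p_c(r), r) + ε,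
where p_c(r) = inf{q : θ⁺(q, r) > 0}: a modulus of right-continuity at the directed-side critical
points, measured from the critical VALUE, uniform as the steering budget β → 0.
PercolationContinuityZ3 implies it (θ⁺(p, r) ≤ θ(p) ≤ θ(p_c/r + δ)); with BackboneSteering and
DiodeEnhancement it implies PercolationContinuityZ3 (Assembly). Its constructive content on the
directed side: how fast does the admissible block scale L(β) of the steering criterion blow up.
[deps: BackboneSteering, DiodeEnhancement] [difficulty: open-problem] (why it might fail: it is the
conjunct's residue (barrier SlabLimitUniformControl in orientation clothing): in a jump world with
BackboneSteering true it is false, since θ⁺(p_c/r, r) ≥ θ(p_c) > 0 = θ⁺(p_c(r), r) while p_c/r −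
p_c(r) → 0; volume-order Russo bounds need φ > 3ν ≈ 2.6.) [DuminilCopinSidoraviciusTassion2016,
Grimmett1999, JanssenStenull2000, ZhouEtAl2012,
Literature.Barriers.CriticalPhenomena.SlabLimitUniformControl]
#9 RDMonotone (support) — θ⁺ is monotone in the two thresholds: p ≤ p′ and p·r ≤ p′·r′ imply θ⁺(p,
r) ≤ θ⁺(p′, r′) (pointwise inclusion of the step relations under the identity coupling of labels;
proved in the planner's Sketch.lean by `Relation.ReflTransGen.mono` + `measureReal_mono`).
[difficulty: provable-now] [Grimmett1999]
#9 RDEndpoint (support) — the r = 1 endpoint is Bernoulli bond percolation: θ⁺(p, 1) = θ_{ℤ³}(p) for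
p ∈ [0,1] (at r = 1 the step relation is adjacency in `openGraph (configOfLabels p U (zdGraph 3))`,
`Relation.ReflTransGen` of adjacency is `Reachable`, and `map_configOfLabels_holds` pushes
`labelMeasure` to `bondPercolation`; measurability by `measurableSet_percolatesAt_holds`).
[difficulty: provable-now] [Grimmett1999]

TWO-LAYER PLAN. Foreseen glued splits (k ≤ 3, depth 1), filed only after a crux closes or stalls
with a census:
BackboneSteering ⇐ TimeLikeCone → ConeSteeringCriterion → BackboneSteering (TimeLikeCone: at p
slightly above p_c(r),
P(0 →⁺ {height ≤ −n}) ≤ e^{−cn}; ConeSteeringCriterion: cone confinement + subcritical backbone ⟹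
same-parameter
finite-size criterion ⟹ openness); SmallLeakSteering ⇐ LeakPathCounting → FattenedBlockSteering →
SmallLeakSteering;
DiodeEnhancement ⇐ ThreeStateRusso → DiodePivotalSurgery → DiodeEnhancement; UniformSteering ⇐
BlockScaleBound
(L₀(r) admissible scale) → AGGapBound (γ(r) = p_c/r − p_c(r)) → UniformSteering via the
Margulis–Russo glue
η ≤ C·L₀(r)³·γ(r) (needs L₀(r)³γ(r) → 0 along r ↑ 1).

KILL CRITERIA. ¬BackboneSteering (a discontinuous forward transition with subcritical backbone, or a
proof that critical forward
clusters are not cone-confined for some r < 1 so that no same-parameter criterion exists) closes the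
route
`refuted:BackboneSteering` — the ladder's premise is gone. ¬SmallLeakSteering alone kills it a
fortiori. ¬UniformSteering
REFUTES THE CONJUNCT (U is implied by PercolationContinuityZ3): hand the witness to the negative
side, close every
continuity route. ¬DiodeEnhancement does not kill but pivots: then (p_c, b) lies ON the critical
curve for small b > 0
and PercolationContinuityZ3 ⟸ continuity of θ⁺ at one directed-side critical point with CRITICAL
backbone (new crux
CriticalBackboneSteering, GH10's sprinkled regime). A same-p slab/full-space criterion proved
elsewhere
(PercOpenSupercrit-type) moots UniformSteering's role; GH02-type continuity for partially oriented
models appearing in print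
makes SmallLeakSteering `known`.

NOT DECOMPOSED YET. TimeLikeCone and the block events/scales of the steering criterion (children of
BackboneSteering; the cone constant
must come from DP-class anisotropy, not from sharpness of the backbone); the three-state Russo
formula and the
pivotal surgery (children of DiodeEnhancement); continuity and strict monotonicity of r ↦ p_c(r);
the quantitative
residue 'L₀(r)³·γ(r) → 0' and any sharp-threshold (OSSS) improvement of the volume factor; the 2-D
calibration
(Dhar–Barma–Phani duality) and the card's orientation-fragility dossier item D (belongs to
PercThresholdOne); a
Literature definition of θ⁺ (requested below) that would shorten every statement.

CHEAPEST FALSIFIER. Lookup first: is 'θ(p_c) = 0 for oriented percolation on ℤ^d perturbed by a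
small density of two-way (or reversed)
bonds' already in print (perturbations of BG90/GH02; Kesten–Sidoravicius–Vares-type oriented
percolation in random
environment; Lipschitz/admissible percolation GrimmettHolroyd2010–2012)? — searched (see Novelty),
not found; a hit
downgrades SmallLeakSteering to known and leaves the rest. Computation second (kit, ~2 cpu-h, not
run here: hub is
compute-free and the card's own job was not submitted): locate p_c(r) for r = 0.9, 0.95, 0.98 on L ≤
256 and measure
the backward mass fraction of critical forward clusters, m₋(L) = E|C⁺ ∩ {height < 0}| / E|C⁺|;
BackboneSteering's
mechanism predicts m₋(L) → 0 beyond a crossover scale ~ (1−r)^{−ν/φ}; a flat m₋ at r = 0.9 up to L =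
256 flags the
block scale as astronomically large (expected near r = 1, fatal if already at r = 0.9).

NUMBERS. p_c(ℤ³, bond) ≈ 0.2488; oriented bond p_c(ℤ³) ≈ 0.382 (so r·p_c(r) < p_c automatically for
r ≲ 0.65, heuristically);
DP exponents d = 2+1: β ≈ 0.58, ν_∥ ≈ 1.29, ν_⊥ ≈ 0.73 (critical forward clusters
paraboloid-confined, width ~ length^0.57);
isotropic ν ≈ 0.876, crossover exponent φ = 1.29(5) in d = 2 (JanssenStenull2000), d = 3 numerics
ZhouEtAl2012;
rigorous squeeze of the critical curve at the endpoint: p_c ≤ p_c(r) ≤ p_c/r, i.e. |a_c(b) − p_c| ≤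
b; path-counting
leak bound: P(net backward progress n) ≤ (6a)ⁿ/(1 − 6√(ap)) for 36ap < 1 (so r₀ = 1/36 is admissible
for cone
confinement uniformly in p ≤ 1); naive Margulis–Russo glue for the residue needs L₀(r)³·γ(r) → 0,
i.e. φ > 3ν ≈ 2.6
against the expected φ ≈ 1.1–1.3: the residue will not fall to volume-order influence bounds. Items
at open: 7
(4 cruxes, 2 support, 1 assembly).

DEFINITION REQUESTS. D1 (Literature/Probability/Percolation): `rdReach U p r x y` / `thetaRD p r` —
forward reachability and percolation
probability of the resistor–diode network on `zdGraph 3` over `labelMeasure` (exactly the `let θ` of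
the statements),
with the provable-now lemmas RDMonotone / RDEndpoint restated over it. C1 (cite fact, family
crit-ising): GrimmettHiemer2002
Thm 1 — θ(p_c) = 0 for oriented bond percolation on ℤ^d, d ≥ 2 (alternative model; conventional
model by their §2
remark) = the r = 0 endpoint of SmallLeakSteering.

Novelty: Searches (2026-08-15): `lit search "resistor diode network percolation directed isotropic
crossover"` (local 10 hits:
cond-mat/0003283, cond-mat/0104296, cond-mat/0110560, arXiv:2103.10062, arXiv:2509.05253 …; crossref
15: Redner 1981/82,
RednerBrown1981, Frey–Täuber–Schwabl 1994, Fröjdh–den Nijs 1997, ZhouEtAl2012 — all physics); `lit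
galaxy search
"resistor-diode percolation" --star all` (1 book hit: Hughes–Ninham 1983 proceedings), `"partially
directed percolation"`
and `"randomly oriented percolation"` --star all (0 relevant); `lit vsearch` for the RDN phase
diagram (12 book hits, none
rigorous on partial orientation); `lit frontier CriticalPhenomena --since 2020` and `lit bridges
--cross any` (nothing on
oriented/partially oriented continuity); `lit read arXiv:math/0108062` (GH02 §2–3: Thm 1, bond,
alternative model,
'easily adapted' to conventional) and `lit read arXiv:1002.2623` (GH10 §: admissible paths = free
backward steps, Open
Questions 1–2, Prop 7(b) proved WITH sprinkling); `lit read arXiv:1402.0834` (BBR: AG fine for bond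
on ℤ^d); two
`lit search` queries on partially oriented percolation returned rc 75 (searchd down) — the refuter's
audit of the card
covered them (Grimmett RSA 2001 random orientations, Garet–Marchand ECP 2021, Terra BJPS 2025: no
continuity theorem).
Nearest prior art found: GrimmettHiemer2002 (doi:10.1007/978-1-4612-0063-5_12, Thm 1: the r = 0
endpoint only);
GrimmettHolroyd2010 (arXiv:1002.2623, Prop 7: the opposite extreme r·p ≥ 1, supercri  [refs: 10.1007/978-1-4612-0063-5_12, 10.1103/physreve.62.3173, 2103.10062, 2509.05253, math/0108062, 1002.2623, 1402.0834, doi:10.1007/978-1-4612-0063-5_12, doi:10.1103/physreve.62.3173, RednerBrown1981, ZhouEtAl2012, GrimmettHiemer2002, GrimmettHolroyd2010, BarskyGrimmettNewman1991, Grimmett1999, Redner1982, JanssenStenull2000, DuminilCopinSidoraviciusTassion2016]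

Barriers (technique_class: steering orientation-deformation finite-size-criterion): - technique_class: steering orientation-deformation finite-size-criterion
- Literature.Barriers.CriticalPhenomena.SprinklingRenormalisation: evaded on {a < p_c} by
construction — the block step is same-parameter because a time axis (cone confinement of forward
clusters) lets seeds be steered into unexamined territory, as in BGN's half-space and GH02's
oriented case; NOT evaded at the endpoint a = p_c, r = 1, where β = 0: nothing is claimed there
beyond UniformSteering.
- Literature.Barriers.CriticalPhenomena.SlabLimitUniformControl: applies squarely to
UniformSteering, which is declared the conjunct's residue (and is even implied by the conjunct); the
bet is only that on the directed side the modulus has a constructive source (the block scale L(β)),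
giving the residue a quantitative form L₀(r)³γ(r) → 0 that slabs do not offer.
- Literature.Barriers.CriticalPhenomena.TransverseCrossingsNeedNotMeet: not engaged — no
box-crossing / duality / RSW step; block events are seed-to-facet forward connections glued by
steering and local connection, as in GH02.
- Literature.Barriers.CriticalPhenomena.LongRangeDiscontinuity: consistent — the model stays
nearest-neighbour i.i.d.; the Aizenman–Newman 1/r² mechanism has no analogue and no orientation
axis.
- Literature.Barriers.CriticalPhenomena.RandomClusterFirstOrder: n/a (q = 1, product measures
throughout).
- Literature.Barriers.CriticalPhenomena.TreesPercolatingAtCriticality: n/a (ℤ³ with i.i.d. edge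
types; amenable, transitive).
- Nega

History (route lifecycle, newest last):
- 2026-08-22T11:56:56Z · DORMANT — reconciler: no traction for 5.3 d (last activity item-evidence-added at 2026-08-17T03:49:43Z); parked, not closed — `ledger route dormant route-CriticalPhenomen (operator:999:4020841)
- 2026-08-23T14:50:12Z · REACTIVATED — reconciler: reactivated — activity item-proof-filed at 2026-08-23T13:01:28Z after parking at 2026-08-22T11:56:56Z (operator:999:1655797)
- 2026-08-30T23:18:49Z · DORMANT — reconciler: no traction for 5 d (last activity statement-closed at 2026-08-25T22:11:23Z); parked, not closed — `ledger route dormant route-CriticalPhenomena-Per (operator:999:1621847)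

sub-problem: PercolationContinuityZ3 · status: dormant · opened planner-plancard-CriticalPhenomena-Percolatio-e3e84185-0 2026-08-15T12:11:43Z · rev 3 · ledger route-CriticalPhenomena-PercDiodeSteering
GENERATED by the gate from the ledger (D-0016/17). Provers cite these decls: `theorem foo : Summit.CriticalPhenomena.PercolationContinuityZ3.Theses.PercDiodeSteering.<Decl> := …` in Summits/CriticalPhenomena/PercolationContinuityZ3/Theorems/<Name>.lean.
-/

namespace Summit.CriticalPhenomena.PercolationContinuityZ3.Theses.PercDiodeSteering

open scoped BigOperators Topology Manifold Classical MeasureTheory ProbabilityTheory Matrix InnerProductSpace ComplexConjugate ContinuousMap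
open Filter Set Function TopologicalSpace MeasureTheory

attribute [summit_statement] _root_.PercolationContinuityZ3

/-- item stmt-CriticalPhenomena-7548 · aside · rank 2 · open · by planner
why it might fail: a<p_c gives no time axis: diode+lone-resistor chains go net-backward at every scale, so same-p blocks re-enter examined territory (Grimmett1999 p.162); GH10 Prop 7(b) needed sprinkling once backward steps are free; the half-space trick for bounded backbends (2108.10025) fails for unbounded leaks.
sources: GrimmettHolroyd2010, GrimmettHiemer2002, BezuidenhoutGrimmett1990, BarskyGrimmettNewman1991, Grimmett1999, arXiv:2108.10025
[crux] card R2 (RDNSteering). For every ratio 0 ≤ r < 1 and every p with subcritical resistor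
backbone p·r < p_c(ℤ³): if the RDN percolates forward at (p, r) then it still does at some p′ < p
(same r). Equivalently θ⁺(p_c(r), r) = 0 whenever r·p_c(r) < p_c(ℤ³): continuity on the directed
side of Redner's diagram, by a same-parameter (steering) finite-size criterion whose blocks are
fattened by the backward-leak scale. [difficulty: open-problem] -/
@[route_item "route-CriticalPhenomena-PercDiodeSteering"]
def BackboneSteering : Prop :=
  let θ : ℝ → ℝ → ℝ := (fun p r => (Literature.Probability.Percolation.labelMeasure (Literature.Probability.LatticeModels.Site 3)).real {U | {y : Literature.Probability.LatticeModels.Site 3 | Relation.ReflTransGen (fun x z : Literature.Probability.LatticeModels.Site 3 => (x ⋖ z ∧ U s(x, z) ≤ p) ∨ (z ⋖ x ∧ U s(x, z) ≤ p * r)) 0 y}.Infinite}); ∀ r : ℝ, 0 ≤ r → r < 1 → ∀ p : ℝ, p * r < Literature.Probability.Percolation.criticalProb (Literature.Probability.LatticeModels.zdGraph 3) 0 → 0 < θ p r → ∃ p' < p, 0 < θ p' r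

/-- item stmt-CriticalPhenomena-7549 · aside · rank 3 · open · by planner
why it might fail: Unprinted even at r=0 for the conventional +e_i bond model (GH02 Thm 1: alternative model); for r>0 depth-n leaks occur w.p. ≥(c·pr)^n at all scales, so log-fattened blocks overlap examined collars: neither GH02 fresh-territory steering nor the bounded-backbend half-space trick (2108.10025) applies.
sources: GrimmettHiemer2002, BezuidenhoutGrimmett1990, GrimmettHolroyd2010, arXiv:2108.10025, doi:10.1023/a:1023075815581, Liggett2005
[crux] the first rung above the Grimmett–Hiemer endpoint: there is r₀ > 0 such that for every leak
ratio 0 ≤ r ≤ r₀ (oriented bond percolation on ℤ³ in which a p·r-fraction of labels also opens the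
backward direction) forward percolation is an open condition downward in p, i.e. θ⁺(·, r) vanishes
at its critical point. At r = 0 this is GH02 Thm 1 (conventional model, bond); for 0 < r ≤ r₀
net-backward progress n costs ≤ (6pr)ⁿ uniformly in p ≤ 1 (path counting), so blocks fattened by C
log L collars confine the exploration and GH02's seed-steering should survive. [difficulty: XL] -/
@[route_item "route-CriticalPhenomena-PercDiodeSteering"]
def SmallLeakSteering : Prop :=
  let θ : ℝ → ℝ → ℝ := (fun p r => (Literature.Probability.Percolation.labelMeasure (Literature.Probability.LatticeModels.Site 3)).real {U | {y : Literature.Probability.LatticeModels.Site 3 | Relation.ReflTransGen (fun x z : Literature.Probability.LatticeModels.Site 3 => (x ⋖ z ∧ U s(x, z) ≤ p) ∨ (z ⋖ x ∧ U s(x, z) ≤ p * r)) 0 y}.Infinite}); ∃ r₀ : ℝ, 0 < r₀ ∧ ∀ r : ℝ, 0 ≤ r → r ≤ r₀ → ∀ p : ℝ, 0 < θ p r → ∃ p' < p, 0 < θ p' r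

/-- item stmt-CriticalPhenomena-7550 · support · rank 4 · closed · proved by Summit.CriticalPhenomena.PercolationContinuityZ3.Theorems.diodeEnhancement_proof @ 79f495560189 (prover) · by planner
why it might fail: AG needs 'resistor-pivotal ⟹ diode-pivotal after bounded surgery'; a resistor used BACKWARD has no forward substitute, so the surgery must reroute through a detour with a forward edge while keeping pivotality; a Russo formula for three-state edges and uniformity as b → 0 are needed.
sources: AizenmanGrimmett1991, BalisterBollobasRiordan2014, MartineauSevero2019, Grimmett1999, Redner1982
[crux] card R3 (SubcriticalBackboneAlongTheCurve), in the form the Assembly uses: for every 0 < r <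
1 there is p with p·r < p_c(ℤ³) and θ⁺(p, r) > 0 — at ratio r some percolating point has a
subcritical resistor backbone; equivalently r·p_c(r) < p_c(ℤ³), equivalently a_c(b) < p_c(ℤ³) for
every diode density b > 0 (positive diodes are an essential enhancement of critical bond percolation
for FORWARD reachability). Trivial bounds in tree-provable form: p_c(ℤ³) ≤ p_c(r) ≤ p_c(ℤ³)/r.
[difficulty: L] -/
@[route_item "route-CriticalPhenomena-PercDiodeSteering"]
def DiodeEnhancement : Prop :=
  let θ : ℝ → ℝ → ℝ := (fun p r => (Literature.Probability.Percolation.labelMeasure (Literature.Probability.LatticeModels.Site 3)).real {U | {y : Literature.Probability.LatticeModels.Site 3 | Relation.ReflTransGen (fun x z : Literature.Probability.LatticeModels.Site 3 => (x ⋖ z ∧ U s(x, z) ≤ p) ∨ (z ⋖ x ∧ U s(x, z) ≤ p * r)) 0 y}.Infinite}); ∀ r : ℝ, 0 < r → r < 1 → ∃ p : ℝ, p * r < Literature.Probability.Percolation.criticalProb (Literature.Probability.LatticeModels.zdGraph 3) 0 ∧ 0 < θ p r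

-- `DiodeEnhancement` holds: proved by `Summit.CriticalPhenomena.PercolationContinuityZ3.Theorems.diodeEnhancement_proof` @ 79f495560189 (its module imports this route file, so no `_holds` link can be stated here).

/-- item stmt-CriticalPhenomena-7551 · aside · rank 5 · closed · proved by Summit.CriticalPhenomena.PercolationContinuityZ3.Theorems.DiodeSteeringUniformSteering.uniformSteering_proof @ 712e5f24aba1 (prover) · by planner
why it might fail: The conjunct's residue: PercolationContinuityZ3 ⟹ U and BS+DE+U ⟹ the conjunct, so in a jump world it is FALSE: θ⁺(p_c/r,r) ≥ θ(p_c) > 0 = θ⁺(p_c(r),r) while p_c/r − p_c(r) → 0. Barrier SlabLimitUniformControl (DST16 Prop 3) applies squarely; volume-order Russo glue needs φ > 3ν ≈ 2.6 vs φ ≈ 1.2.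
sources: DuminilCopinSidoraviciusTassion2016, Literature.Barriers.CriticalPhenomena.SlabLimitUniformControl, Grimmett1999, JanssenStenull2000, ZhouEtAl2012
[crux] card R4 recast as the exact residue: for every ε > 0 there are δ > 0 and r₀ < 1 such that for
all r ∈ [r₀, 1) and all p ∈ [p_c(r), p_c(r) + δ], θ⁺(p, r) ≤ θ⁺(p_c(r), r) + ε, where p_c(r) = inf{q
: θ⁺(q, r) > 0}: a modulus of right-continuity at the directed-side critical points, measured from
the critical VALUE, uniform as the steering budget β → 0. PercolationContinuityZ3 implies it (θ⁺(p,
r) ≤ θ(p) ≤ θ(p_c/r + δ)); with BackboneSteering and DiodeEnhancement it implies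
PercolationContinuityZ3 (Assembly). Its constructive content on the directed side: how fast does the
admissible block scale L(β) of the steering criterion blow up. [deps: BackboneSteering,
DiodeEnhancement] [difficulty: open-problem] -/
@[route_item "route-CriticalPhenomena-PercDiodeSteering"]
def UniformSteering : Prop :=
  let θ : ℝ → ℝ → ℝ := (fun p r => (Literature.Probability.Percolation.labelMeasure (Literature.Probability.LatticeModels.Site 3)).real {U | {y : Literature.Probability.LatticeModels.Site 3 | Relation.ReflTransGen (fun x z : Literature.Probability.LatticeModels.Site 3 => (x ⋖ z ∧ U s(x, z) ≤ p) ∨ (z ⋖ x ∧ U s(x, z) ≤ p * r)) 0 y}.Infinite}); ∀ ε > (0 : ℝ), ∃ δ > (0 : ℝ), ∃ r₀ < (1 : ℝ), ∀ r : ℝ, r₀ ≤ r → r < 1 → ∀ p : ℝ, sInf {q : ℝ | 0 < θ q r} ≤ p → p ≤ sInf {q : ℝ | 0 < θ q r} + δ → θ p r ≤ θ (sInf {q : ℝ | 0 < θ q r}) r + ε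

-- `UniformSteering` holds: proved by `Summit.CriticalPhenomena.PercolationContinuityZ3.Theorems.DiodeSteeringUniformSteering.uniformSteering_proof` @ 712e5f24aba1 (its module imports this route file, so no `_holds` link can be stated here).

/-- item stmt-CriticalPhenomena-7552 · support · rank 9 · closed · proved by Summit.CriticalPhenomena.PercolationContinuityZ3.Theorems.PercDiodeSteeringRDMonotone.rDMonotone_proof @ d224704e6d3c (prover) · by planner
sources: Grimmett1999
[support] θ⁺ is monotone in the two thresholds: p ≤ p′ and p·r ≤ p′·r′ imply θ⁺(p, r) ≤ θ⁺(p′, r′)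
(pointwise inclusion of the step relations under the identity coupling of labels; proved in the
planner's Sketch.lean by `Relation.ReflTransGen.mono` + `measureReal_mono`). [difficulty:
provable-now] -/
@[route_item "route-CriticalPhenomena-PercDiodeSteering"]
def RDMonotone : Prop :=
  let θ : ℝ → ℝ → ℝ := (fun p r => (Literature.Probability.Percolation.labelMeasure (Literature.Probability.LatticeModels.Site 3)).real {U | {y : Literature.Probability.LatticeModels.Site 3 | Relation.ReflTransGen (fun x z : Literature.Probability.LatticeModels.Site 3 => (x ⋖ z ∧ U s(x, z) ≤ p) ∨ (z ⋖ x ∧ U s(x, z) ≤ p * r)) 0 y}.Infinite}); ∀ p p' r r' : ℝ, p ≤ p' → p * r ≤ p' * r' → θ p r ≤ θ p' r'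

-- `RDMonotone` holds: proved by `Summit.CriticalPhenomena.PercolationContinuityZ3.Theorems.PercDiodeSteeringRDMonotone.rDMonotone_proof` @ d224704e6d3c (its module imports this route file, so no `_holds` link can be stated here).

/-- item stmt-CriticalPhenomena-7553 · support · rank 9 · closed · proved by Summit.CriticalPhenomena.PercolationContinuityZ3.Theorems.PercDiodeSteeringRDEndpoint.rDEndpoint_proof @ 94a64a9dca3e (prover) · by planner
sources: Grimmett1999
[support] the r = 1 endpoint is Bernoulli bond percolation: θ⁺(p, 1) = θ_{ℤ³}(p) for p ∈ [0,1] (at r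
= 1 the step relation is adjacency in `openGraph (configOfLabels p U (zdGraph 3))`,
`Relation.ReflTransGen` of adjacency is `Reachable`, and `map_configOfLabels_holds` pushes
`labelMeasure` to `bondPercolation`; measurability by `measurableSet_percolatesAt_holds`).
[difficulty: provable-now] -/
@[route_item "route-CriticalPhenomena-PercDiodeSteering"]
def RDEndpoint : Prop :=
  let θ : ℝ → ℝ → ℝ := (fun p r => (Literature.Probability.Percolation.labelMeasure (Literature.Probability.LatticeModels.Site 3)).real {U | {y : Literature.Probability.LatticeModels.Site 3 | Relation.ReflTransGen (fun x z : Literature.Probability.LatticeModels.Site 3 => (x ⋖ z ∧ U s(x, z) ≤ p) ∨ (z ⋖ x ∧ U s(x, z) ≤ p * r)) 0 y}.Infinite}); ∀ p : unitInterval, θ p 1 = Literature.Probability.Percolation.theta (Literature.Probability.LatticeModels.zdGraph 3) 0 p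

-- `RDEndpoint` holds: proved by `Summit.CriticalPhenomena.PercolationContinuityZ3.Theorems.PercDiodeSteeringRDEndpoint.rDEndpoint_proof` @ 94a64a9dca3e (its module imports this route file, so no `_holds` link can be stated here).

/-- item stmt-CriticalPhenomena-7554 · assembly · rank 1 · closed · proved by Summit.CriticalPhenomena.PercolationContinuityZ3.Theorems.PercDiodeSteeringAssembly.assembly_proof @ 33706488ffa0 (prover) · by planner
sources: Grimmett1999, DuminilCopinSidoraviciusTassion2016
[assembly] BackboneSteering → DiodeEnhancement → UniformSteering → RDMonotone → RDEndpoint →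
PercolationContinuityZ3. -/
@[route_item "route-CriticalPhenomena-PercDiodeSteering"]
def Assembly : Prop :=
  BackboneSteering → DiodeEnhancement → UniformSteering → RDMonotone → RDEndpoint → PercolationContinuityZ3

-- `Assembly` holds: proved by `Summit.CriticalPhenomena.PercolationContinuityZ3.Theorems.PercDiodeSteeringAssembly.assembly_proof` @ 33706488ffa0 (its module imports this route file, so no `_holds` link can be stated here).

/-! D-0027 §2.1 — DECIDING THEOREM (planner-authored via `route open/edit --closes-file`; by planner-rrepair-CriticalPhenomena-PercDiodeSte-7fdd4200-g3-0 2026-08-15T16:58:40Z):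
its hypotheses are this route's items and its conclusion the sub-problem Statement (glue_lint), and it elaborates with this file. -/

@[closes "route-CriticalPhenomena-PercDiodeSteering"] theorem closes : BackboneSteering → DiodeEnhancement → UniformSteering → RDMonotone → RDEndpoint →
    _root_.PercolationContinuityZ3 := by
  /- (0) The assembly argument over an ABSTRACT forward-percolation probability `θ p r` and
     critical value `pc`: real analysis only. -/
  have key : ∀ (θ : ℝ → ℝ → ℝ) (pc : ℝ), (∀ p r, 0 ≤ θ p r) → 0 ≤ pc → pc ≤ 1 →
      (∀ r : ℝ, 0 ≤ r → r < 1 → ∀ p : ℝ, p * r < pc → 0 < θ p r → ∃ p' < p, 0 < θ p' r) →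
      (∀ r : ℝ, 0 < r → r < 1 → ∃ p : ℝ, p * r < pc ∧ 0 < θ p r) →
      (∀ ε > (0 : ℝ), ∃ δ > (0 : ℝ), ∃ r₀ < (1 : ℝ), ∀ r : ℝ, r₀ ≤ r → r < 1 → ∀ p : ℝ,
          sInf {q : ℝ | 0 < θ q r} ≤ p → p ≤ sInf {q : ℝ | 0 < θ q r} + δ →
          θ p r ≤ θ (sInf {q : ℝ | 0 < θ q r}) r + ε) →
      (∀ p p' r r' : ℝ, p ≤ p' → p * r ≤ p' * r' → θ p r ≤ θ p' r') →
      (∀ q : ℝ, q < pc → θ q 1 = 0) →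
      θ pc 1 = 0 := by
    intro θ pc h0 hpc0 hpc1 hBS hDE hU hM hZ
    refine le_antisymm ?_ (h0 pc 1)
    refine le_of_forall_pos_le_add fun ε hε => ?_
    -- the residue U gives a modulus δ and a threshold r₀
    obtain ⟨δ, hδ, r₀, hr₀, hUr⟩ := hU ε hε
    -- a ratio r close to 1: r₀ ≤ r, 1/2 ≤ r, 1 - δ/2 ≤ r, r < 1
    set r : ℝ := max r₀ (max (1 / 2) (1 - δ / 2)) with hr_def
    have hr₀r : r₀ ≤ r := le_max_left _ _
    have hr_half : 1 / 2 ≤ r := (le_max_left _ _).trans (le_max_right _ _)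
    have hr_δ : 1 - δ / 2 ≤ r := (le_max_right _ _).trans (le_max_right _ _)
    have hr0 : 0 < r := by linarith
    have hr1 : r < 1 := max_lt hr₀ (max_lt (by norm_num) (by linarith))
    -- below pc nothing percolates forward at ratio r
    have hlb : ∀ q : ℝ, 0 < θ q r → pc ≤ q := by
      intro q hq
      by_contra hlt
      have hlt : q < pc := not_le.mp hlt
      have hle : θ q r ≤ 0 := by
        rcases le_or_gt 0 q with hq0 | hq0
        · calc θ q r ≤ θ q 1 := hM q q r 1 le_rfl (by nlinarith)
            _ = 0 := hZ q hlt
        · calc θ q r ≤ θ (q * r) 1 := hM q (q * r) r 1 (by nlinarith) (by rw [mul_one])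
            _ = 0 := hZ (q * r) ((mul_neg_of_neg_of_pos hq0 hr0).trans_le hpc0)
      linarith
    -- DE: a forward-percolating point p₁ with subcritical backbone p₁·r < pc
    obtain ⟨p₁, hp₁, hθp₁⟩ := hDE r hr0 hr1
    -- the directed-side critical point p* = inf S, S = {q | θ q r > 0}
    set S : Set ℝ := {q : ℝ | 0 < θ q r} with hS_def
    have hSne : S.Nonempty := ⟨p₁, hθp₁⟩
    have hSbdd : BddBelow S := ⟨pc, fun q hq => hlb q hq⟩
    have hpc_le : pc ≤ sInf S := le_csInf hSne fun q hq => hlb q hq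
    have hle_p₁ : sInf S ≤ p₁ := csInf_le hSbdd hθp₁
    have hsub : sInf S * r < pc := (mul_le_mul_of_nonneg_right hle_p₁ hr0.le).trans_lt hp₁
    -- BS: θ vanishes at p* (a smaller percolating point would undercut the infimum)
    have hstar : θ (sInf S) r = 0 := by
      by_contra hne
      have hpos : 0 < θ (sInf S) r := lt_of_le_of_ne (h0 _ _) (Ne.symm hne)
      obtain ⟨p', hp', hθp'⟩ := hBS r hr0.le hr1 (sInf S) hsub hpos
      exact absurd (csInf_le hSbdd hθp') (not_le.mpr hp')
    -- the comparison point P = pc / r: P·r = pc, pc ≤ P ≤ pc + δ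
    have hPr : pc / r * r = pc := div_mul_cancel₀ pc hr0.ne'
    have hpcP : pc ≤ pc / r := by
      rw [le_div_iff₀ hr0]
      nlinarith
    have hPδ : pc / r ≤ pc + δ := by
      rw [div_le_iff₀ hr0]
      nlinarith [mul_nonneg (sub_nonneg.2 hpc1) (sub_nonneg.2 hr1.le), mul_nonneg hδ.le (by linarith : (0 : ℝ) ≤ r - 1 / 2)]
    -- θ(pc) = θ pc 1 ≤ θ P r (monotone coupling: pc ≤ P and pc·1 ≤ P·r)
    have hmono : θ pc 1 ≤ θ (pc / r) r := hM pc (pc / r) 1 r hpcP (by rw [hPr, mul_one])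
    -- θ P r ≤ ε: either P < p* (then θ P r = 0) or p* ≤ P ≤ p* + δ (then U applies)
    have hP : θ (pc / r) r ≤ 0 + ε := by
      rcases lt_or_ge (pc / r) (sInf S) with hlt | hge
      · have hzero : θ (pc / r) r = 0 := by
          by_contra hne
          have hpos : 0 < θ (pc / r) r := lt_of_le_of_ne (h0 _ _) (Ne.symm hne)
          exact absurd (csInf_le hSbdd hpos) (not_le.mpr hlt)
        rw [hzero, zero_add]
        exact hε.le
      · have := hUr r hr₀r hr1 (pc / r) hge (hPδ.trans (by linarith))
        rw [hstar] at this
        exact this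
    exact hmono.trans hP
  /- (1) Instantiate with the resistor–diode network on ℤ³: name its forward percolation
     probability θ (the common `let θ` of every item) and p_c(ℤ³). -/
  show (let θ : ℝ → ℝ → ℝ := (fun p r => (Literature.Probability.Percolation.labelMeasure (Literature.Probability.LatticeModels.Site 3)).real {U | {y : Literature.Probability.LatticeModels.Site 3 | Relation.ReflTransGen (fun x z : Literature.Probability.LatticeModels.Site 3 => (x ⋖ z ∧ U s(x, z) ≤ p) ∨ (z ⋖ x ∧ U s(x, z) ≤ p * r)) 0 y}.Infinite});
    (∀ r : ℝ, 0 ≤ r → r < 1 → ∀ p : ℝ, p * r < Literature.Probability.Percolation.criticalProb (Literature.Probability.LatticeModels.zdGraph 3) 0 → 0 < θ p r → ∃ p' < p, 0 < θ p' r) →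
    (∀ r : ℝ, 0 < r → r < 1 → ∃ p : ℝ, p * r < Literature.Probability.Percolation.criticalProb (Literature.Probability.LatticeModels.zdGraph 3) 0 ∧ 0 < θ p r) →
    (∀ ε > (0 : ℝ), ∃ δ > (0 : ℝ), ∃ r₀ < (1 : ℝ), ∀ r : ℝ, r₀ ≤ r → r < 1 → ∀ p : ℝ, sInf {q : ℝ | 0 < θ q r} ≤ p → p ≤ sInf {q : ℝ | 0 < θ q r} + δ → θ p r ≤ θ (sInf {q : ℝ | 0 < θ q r}) r + ε) →
    (∀ p p' r r' : ℝ, p ≤ p' → p * r ≤ p' * r' → θ p r ≤ θ p' r') →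
    (∀ p : unitInterval, θ p 1 = Literature.Probability.Percolation.theta (Literature.Probability.LatticeModels.zdGraph 3) 0 p) →
    Literature.Probability.Percolation.theta (Literature.Probability.LatticeModels.zdGraph 3) (0 : Literature.Probability.LatticeModels.Site 3) (Literature.Probability.Percolation.criticalProbI 3) = 0)
  intro θ hBS hDE hU hM hE
  have hpc := Literature.Probability.Percolation.criticalProb_mem_Icc (Literature.Probability.LatticeModels.zdGraph 3) (0 : Literature.Probability.LatticeModels.Site 3)
  -- θ(p_c) on ℤ³ is the r = 1 endpoint of the network at p = p_c (RDEndpoint)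
  rw [← hE (Literature.Probability.Percolation.criticalProbI 3), Literature.Probability.Percolation.coe_criticalProbI]
  refine key θ _ (fun p r => MeasureTheory.measureReal_nonneg) hpc.1 hpc.2 hBS hDE hU hM ?_
  -- below p_c the endpoint does not percolate: θ q 1 = θ_{ℤ³}(q) = 0 for 0 ≤ q < p_c, and θ q 1 ≤ θ 0 1 = θ_{ℤ³}(0) = 0 for q < 0
  intro q hq
  rcases le_or_gt 0 q with hq0 | hq0
  · have hq1 : q ≤ 1 := hq.le.trans hpc.2
    have hEq : θ q 1 = Literature.Probability.Percolation.theta (Literature.Probability.LatticeModels.zdGraph 3) 0 ⟨q, hq0, hq1⟩ := hE ⟨q, hq0, hq1⟩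
    rw [hEq]
    exact Literature.Probability.Percolation.theta_eq_zero_of_lt_criticalProb_holds (Literature.Probability.LatticeModels.zdGraph 3) 0 ⟨q, hq0, hq1⟩ hq
  · have hE0 : θ 0 1 = Literature.Probability.Percolation.theta (Literature.Probability.LatticeModels.zdGraph 3) 0 0 := hE 0
    have hle : θ q 1 ≤ θ 0 1 := hM q 0 1 1 hq0.le (by linarith)
    rw [hE0, Literature.Probability.Percolation.theta_bot] at hle
    exact le_antisymm hle MeasureTheory.measureReal_nonneg

end Summit.CriticalPhenomena.PercolationContinuityZ3.Theses.PercDiodeSteering
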